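import Literature.IUT.LogThetaLattice.PacketLogVolumes
import Literature.IUT.LogVolume.HaarTransport
import Mathlib.MeasureTheory.Measure.Haar.InnerProductSpace
import Mathlib.Analysis.Complex.Basic
import HarnessLib

/-!
# [IUTchIII] Proposition 3.9 (ii), continued: the integral-structure ADJUSTMENT and the ARCHIMEDEAN model
# (abc-iut cell, layer L6; proof-only companion 3 of `PacketLogVolumes.lean`, board row F4 of
# `plan/L6/DISCHARGE-L6.md` v1.5; sibling of `PacketLogVolumesProofs2.lean`)

S. Mochizuki, *Inter-universal Teichmüller theory III*, kurims manuscript (May 2020), Proposition 3.9 (ii)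
"(Mono-analytic Compatibility)", p. 116 [claim: Mochizuki2012, status: disputed]: "… by applying the
`p_{v_ℚ}`-adic log-volume … on the mono-analytic log-shells … and adjusting appropriately to account for the
discrepancy between the 'local holomorphic' integral structures of Proposition 3.1, (ii), and the
'mono-analytic' integral structures of Proposition 3.2, (ii), one obtains … log-volumes … which are
compatible with the log-volumes obtained in (i), relative to the natural poly-isomorphisms of Proposition
3.2, (i)" — and (i), p. 116: "likewise at archimedean `v_ℚ` with radial log-volumes".

`PacketLogVolumesProofs2.lean` (abc-iut-L6-d3) concluded abc-iut-L6-t4's `Prop39ii_monoAnalyticCompat` BY NAME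
at the nonarchimedean Haar models for lattice-respecting poly-isomorphisms. This file adds:

* **the ADJUSTMENT made precise** (`monoAnalyticLogVolume_adjusted_eq`, `prop39ii_monoAnalyticCompat_adjusted`):
  the mono-analytic side sees only the mono-analytic integral structure `Λ_I` (the log-shell lattice) and
  outputs the `Λ_I`-normalised log-volume SHIFTED by the constant `μ^log_hol(𝓘)` (the holomorphic
  log-volume of the log-shell — the number Remark 3.9.4 / [IUTchIV] Prop. 1.4 compute from `(e_v, d_v)`;
  abc-iut-L6-d4/d5, abc-iut-L6-d2 `HolomorphicLogShells`); along any bicontinuous additive isomorphism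
  carrying `Λ_I` onto the log-shell lattice of the holomorphic container this adjusted volume EQUALS the
  `𝒪`-normalised holomorphic log-volume of the image, on every region of positive finite volume (the
  "`𝕄(−)`"): campaign-S `IntegralStructure.logVolume_eq_logVolume_sub` (change of integral structure,
  [AbsTopIII] Prop. 5.7 (i)(a)) + `logVolume_image_equiv` (Haar transport);
* **the ARCHIMEDEAN model** (`prop39ii_monoAnalyticCompat_arch`, `prop39ii_monoAnalyticCompat_complex_pmConj`):
  the containers at `v_ℚ = ∞` are finite-dimensional real inner product spaces (`ℝ`, `ℂ`, direct sums), every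
  log-volume in use is a FUNCTION of the Lebesgue/Haar volume (the radial log-volume of Prop. 3.9 (i),
  [AbsTopIII] Prop. 5.7 (ii)), and linear isometries — `±1`, complex conjugation, unitary maps, isometric
  isomorphisms `E ⥲ E'` — preserve the volume of EVERY set (Mathlib `LinearIsometryEquiv.measurePreserving`),
  hence `Prop39ii_monoAnalyticCompat` BY NAME for such poly-isomorphisms.

Honest framing: theorems of Haar/Lebesgue measure in the typer's vocabulary; the poly-isomorphism of Prop.
3.2 (i) on actual `𝒟^⊢`-prime-strips is abc-iut-L6-t3/L5 material. Nothing here asserts a disputed claim or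
takes a side on [IUTchIII] Cor. 3.12; typed ≠ endorsed. [cite: MochizukiAbsTopIII2015, Prop. 5.7 (i)(ii)]
-/

noncomputable section

namespace Literature.IUT.LogThetaLattice

open Literature.IUT.LogVolume Literature.IUT.LogVolume.IntegralStructure MeasureTheory Set

universe u v

/-! ### "Adjusting … for the discrepancy between the … integral structures" (p. 116) -/

section Adjustment

open scoped ENNReal

variable {XD : Type u} [AddCommGroup XD] [TopologicalSpace XD] [IsTopologicalAddGroup XD]
  [MeasurableSpace XD] [BorelSpace XD]
variable {XF : Type u} [AddCommGroup XF] [TopologicalSpace XF] [IsTopologicalAddGroup XF]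
  [MeasurableSpace XF] [BorelSpace XF]

/-- Positivity and finiteness of the holomorphic volume of the transported region. [folklore] -/
private theorem haar_image_pos_lt_top (ΛI : IntegralStructure XD) (ΛIF ΛO : IntegralStructure XF)
    (φ : XD ≃ₜ+ XF) (hφ : φ '' (ΛI : Set XD) = (ΛIF : Set XF)) {S : Set XD} (hS : 0 < ΛI.haar S)
    (hS' : ΛI.haar S < ∞) : 0 < ΛO.haar (φ '' S) ∧ ΛO.haar (φ '' S) < ∞ := by
  have h0 : ΛIF.haar (ΛO : Set XF) ≠ 0 := (ΛIF.haar_pos_of_isOpen ΛO.isOpen ΛO.nonempty).ne'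
  have ht : ΛIF.haar (ΛO : Set XF) ≠ ∞ := (ΛIF.haar_lt_top_of_isCompact ΛO.isCompact).ne
  have hφS : ΛIF.haar (φ '' S) = ΛI.haar S := ΛI.haar_image_equiv ΛIF φ hφ S
  rw [ΛIF.haar_eq_smul_haar ΛO, Measure.smul_apply, smul_eq_mul, hφS]
  refine ⟨ENNReal.mul_pos (ENNReal.inv_ne_zero.mpr ht) hS.ne', ?_⟩
  exact ENNReal.mul_lt_top (ENNReal.inv_lt_top.mpr (pos_iff_ne_zero.mpr h0)) hS'

/-- **"adjusting appropriately to account for the discrepancy between the 'local holomorphic' integral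
structures of Proposition 3.1, (ii), and the 'mono-analytic' integral structures of Proposition 3.2, (ii)"**
([IUTchIII] Prop. 3.9 (ii), p. 116) made precise at the Haar model: the mono-analytic side `XD` sees only the
mono-analytic integral structure `Λ_I` (the log-shell lattice `𝓘(^α𝒟^⊢_{v_ℚ})`) and outputs the
`Λ_I`-normalised log-volume SHIFTED by the constant `c = μ^log_hol(𝓘)` (the holomorphic log-volume of the
log-shell, computed group-theoretically in Remark 3.9.4 / [IUTchIV] Prop. 1.4 — here the number
`ΛO.logVolume Λ_IF`); along any bicontinuous additive isomorphism `φ : XD ⥲ XF` carrying `Λ_I` onto the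
log-shell lattice `Λ_IF ⊆ XF`, this ADJUSTED mono-analytic log-volume equals the holomorphic
(`𝒪`-normalised, `ΛO`) log-volume of the image, for every region of positive finite volume (the elements
of "`𝕄(−)`"): `μ^log_I(S) + μ^log_hol(𝓘) = μ^log_hol(φ(S))` (campaign-S `logVolume_eq_logVolume_sub` +
`logVolume_image_equiv`). [claim: Mochizuki2012, status: disputed] -/
theorem monoAnalyticLogVolume_adjusted_eq (ΛI : IntegralStructure XD) (ΛIF ΛO : IntegralStructure XF)
    (φ : XD ≃ₜ+ XF) (hφ : φ '' (ΛI : Set XD) = (ΛIF : Set XF)) (S : Set XD) (hS : 0 < ΛI.haar S)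
    (hS' : ΛI.haar S < ∞) :
    ΛI.logVolume S + ΛO.logVolume (ΛIF : Set XF) = ΛO.logVolume (φ '' S) := by
  obtain ⟨hpos, hfin⟩ := haar_image_pos_lt_top ΛI ΛIF ΛO φ hφ hS hS'
  have h1 : ΛIF.logVolume (φ '' S) = ΛO.logVolume (φ '' S) - ΛO.logVolume (ΛIF : Set XF) :=
    ΛO.logVolume_eq_logVolume_sub ΛIF hpos hfin
  have h2 : ΛIF.logVolume (φ '' S) = ΛI.logVolume S := ΛI.logVolume_image_equiv ΛIF φ hφ S
  linarith

/-- **IUTchIII:Prop3.9(ii) with the adjustment, on the regions `𝕄(−)`**: for a poly-isomorphism of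
bicontinuous additive isomorphisms carrying the mono-analytic lattice `Λ_I` of `XD` onto the log-shell
lattice `Λ_IF` of `XF`, the ADJUSTED mono-analytic log-volume `S ↦ μ^log_I(S) + μ^log_hol(𝓘)` and the
holomorphic log-volume `μ^log_hol` are compatible on every region of positive finite volume.
[claim: Mochizuki2012, status: disputed] -/
theorem prop39ii_monoAnalyticCompat_adjusted (ΛI : IntegralStructure XD) (ΛIF ΛO : IntegralStructure XF)
    (poly : Set (XD ≃ XF))
    (hpoly : ∀ e ∈ poly, ∃ φ : XD ≃ₜ+ XF, (⇑φ : XD → XF) = e ∧ φ '' (ΛI : Set XD) = (ΛIF : Set XF))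
    {e : XD ≃ XF} (he : e ∈ poly) {S : Set XD} (hS : 0 < ΛI.haar S) (hS' : ΛI.haar S < ∞) :
    ΛI.logVolume S + ΛO.logVolume (ΛIF : Set XF) = ΛO.logVolume (e '' S) := by
  obtain ⟨φ, hφe, hφ⟩ := hpoly e he
  rw [← hφe]
  exact monoAnalyticLogVolume_adjusted_eq ΛI ΛIF ΛO φ hφ S hS hS'

end Adjustment

/-! ### The archimedean model: finite-dimensional real inner product spaces and linear isometries -/

section Arch

open scoped ENNReal

variable {E : Type u} [NormedAddCommGroup E] [InnerProductSpace ℝ E] [FiniteDimensional ℝ E]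
  [MeasurableSpace E] [BorelSpace E]
variable {E' : Type u} [NormedAddCommGroup E'] [InnerProductSpace ℝ E'] [FiniteDimensional ℝ E']
  [MeasurableSpace E'] [BorelSpace E']

/-- Linear isometries of finite-dimensional real inner product spaces preserve the Lebesgue (Haar) volume of
EVERY set (Mathlib `LinearIsometryEquiv.measurePreserving`, stated for images of arbitrary sets).
[folklore] -/
private theorem volume_image_linearIsometryEquiv (φ : E ≃ₗᵢ[ℝ] E') (S : Set E) :
    volume ((φ : E → E') '' S) = volume S := by
  have h : (φ : E → E') '' S = (φ.symm : E' → E) ⁻¹' S := by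
    ext y
    constructor
    · rintro ⟨x, hx, rfl⟩
      simpa using hx
    · intro hy
      exact ⟨φ.symm y, hy, φ.apply_symm_apply y⟩
  rw [h]
  exact φ.symm.measurePreserving.measure_preimage_emb φ.symm.toHomeomorph.measurableEmbedding S

/-- **IUTchIII:Prop3.9(ii) at the ARCHIMEDEAN model** (`v_ℚ = ∞`: the containers are finite-dimensional real
inner product spaces, e.g. `K_v = ℝ, ℂ` or a direct sum of them, with any log-volume that is a FUNCTION
of the Lebesgue/Haar volume — the radial log-volume of Prop. 3.9 (i) and [AbsTopIII] Prop. 5.7 (ii) is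
such a function): a poly-isomorphism consisting of LINEAR ISOMETRIES (`±1`, complex conjugation, unitary
maps, isometric isomorphisms between two models `E ≅ E'`) is compatible with the log-volumes.
[claim: Mochizuki2012, status: disputed] -/
theorem prop39ii_monoAnalyticCompat_arch (f : ℝ≥0∞ → ℝ) (poly : Set (E ≃ E'))
    (hpoly : ∀ e ∈ poly, ∃ φ : E ≃ₗᵢ[ℝ] E', (⇑φ : E → E') = e) :
    Prop39ii_monoAnalyticCompat poly (fun S => f (volume S)) (fun S => f (volume S)) := by
  intro e he S
  obtain ⟨φ, hφe⟩ := hpoly e he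
  rw [← hφe]
  exact (congrArg f (volume_image_linearIsometryEquiv φ S)).symm

/-- The archimedean `{±1, complex conjugation}`: on `ℂ` the identity, negation and complex conjugation are
compatible with every log-volume that is a function of the Lebesgue volume. [claim: Mochizuki2012, status: disputed] -/
theorem prop39ii_monoAnalyticCompat_complex_pmConj (f : ℝ≥0∞ → ℝ) :
    Prop39ii_monoAnalyticCompat
      ({Equiv.refl ℂ, Equiv.neg ℂ, Complex.conjLIE.toLinearEquiv.toEquiv} : Set (ℂ ≃ ℂ))
      (fun S => f (volume S)) (fun S => f (volume S)) := by
  refine prop39ii_monoAnalyticCompat_arch f _ fun e he => ?_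
  rcases he with rfl | rfl | he
  · exact ⟨LinearIsometryEquiv.refl ℝ ℂ, rfl⟩
  · exact ⟨LinearIsometryEquiv.neg ℝ, rfl⟩
  · rw [Set.mem_singleton_iff] at he
    subst he
    exact ⟨Complex.conjLIE, rfl⟩

end Arch


end Literature.IUT.LogThetaLattice
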